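import Summits.BirchSwinnertonDyer.BirchSwinnertonDyer.Theorems.GenusKolyvaginAtTwoShaCardDvdPowAtTwoPosTSharpExponentRatOfRegularPairSupplyCorollaries
import Summits.BirchSwinnertonDyer.BirchSwinnertonDyer.Theorems.GenusKolyvaginAtTwoShaCardDvdPowAtTwoPosTRegularSignedPairChebotarev
import Summits.BirchSwinnertonDyer.BirchSwinnertonDyer.Theorems.GenusKolyvaginAtTwoPowDvdShaCardAtTwoRTDeepPairChebotarev
import Literature.NumberTheory.Automorphic.TunnellLemma
import HarnessLib

/-!
# Route `GenusKolyvaginAtTwo`, crux L⁺_T `PowDvdShaCardAtTwoPosT` (stmt-BirchSwinnertonDyer-23379), road (E4)⁺, socket swap⁺ —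
# THE DEEP FULL-ORDER PAIR ČEBOTAREV AT TRANSPOSITION-DEEP KOLYVAGIN PRIMES, SIGN-FREE IN `Δ`, BEYOND EVERY BOUND
# (replaces `…RTDeepPairChebotarev.infinite_kolyvaginPrime_localization_fullOrder_pair_deep`, the `Δ < 0` supply of the exact swap)

Seat `bsd-line-gk2-p5` g32 (WIDTH-5 attach, cell `bsd-f1-sign2`), `--supports stmt-BirchSwinnertonDyer-23379` (helper; closes nothing).
THEOREMS ONLY (no definition, no named fact, no `sorry`).  BSD is NOT proved by any of this; neither is L⁺_T nor any stub.

WHY (LEAD gk2-p1 g20 memo R10 §0.3 «swap⁺», ruling R10′).  LEAD g18's exact prime swap `exactSwap_core_frob` (`…RTExactSwapCoreFrob`) touches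
`Δ < 0` at two points: the exact local laws P7a⁼/P7b⁼ (ported sign-free in `…PosTExactSwapLaw{Kummer,Transverse}Transposition`) and the
ČEBOTAREV SUPPLY of the fresh prime, `infinite_kolyvaginPrime_localization_fullOrder_pair_deep` (gk2-p2's pair theorem on `Δ < 0`: Kolyvagin primes
with `Frob_ℓ = Frob_∞` on `K(E[2^{M+k}])` and EXACT local orders of two eigenclasses).  On `Δ > 0` the right class is the TRANSPOSITION class
(«some Frobenius above `ℓ` moves a point of `E[2]`»), supplied with full-order pair localisation by gk2-p4 g23's Part C
`RegularSigned.exists_regular_kolyvaginPrime_fullOrder_signedPair_of_heegner` (Čebotarev input = `Automorphic.chebotarev_artinRep_of_galoisSide`,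
a theorem) for EITHER sign of `Δ`.  THIS FILE packages Part C in the swap's currency:
* `exists_transposition_kolyvaginPrime_fullOrder_pair_gt` — level `2^L` (`L ≥ 1`): for two `c`-eigenclasses `x, y ∈ H¹(K, E[2^L])` of orders
  `2^m, 2^κ` (`m, κ ≥ 1`, any signs) with the separation hypothesis on `⟨x, y⟩`, and any bound `b`, a Zhang–Kolyvagin prime `ℓ > b` of index
  `≥ L`, of TRANSPOSITION type, at whose place `x` has local order exactly `2^m` and `y` exactly `2^κ` (iff-currency of `torsionLocalKer`) —
  gk2-p5 g31's `regularPairSupply_of_heegner` with the bound kept;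
* **`exists_transposition_kolyvaginPrime_localization_fullOrder_pair_deep`** — the DEEP form consumed by the swap: classes at level `2^M`, the
  separation hypothesis read at level `2^{M+k}` through `ι = H¹(E[2^M] ↪ E[2^{M+k}])`, output prime of index `≥ M + k` outside any finite `X`,
  transposition type, exact local orders at level `2^M` — the `ι`-shift of `…RTDeepPairChebotarev` verbatim (`ι` injective:
  `torsionH1OfDvd_two_pow_injective`; `Γ_{K_λ}` fixes `E[2^{M+k}]`: `galoisRep_toLocal_apply_eq_self`).
Frame: `E/ℚ` globally minimal, `ρ_{E,2^n}` onto for all `n ≥ 1`, `K` imaginary quadratic with ODD `d_K` satisfying the Heegner hypothesis for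
`N_E` — NO sign of `Δ`, NO non-square side condition, NO `¬ CM`.

References: [McCallumLMS1991] §3 Cor. 3.2, §4 (5) and Lemma 4.6, §5 proof of Prop. 5.2 ((11)–(13)); [GrossLMS1991] §3 (3.1)–(3.3), §9 Prop. 9.3;
[Howard2004Duke] Thm. 3.2.2 (proof).
-/

set_option autoImplicit false
-- the Theorems namespace of this sub repeats the summit name by design (D-0017 nested layout)
set_option linter.dupNamespace false

noncomputable section

open scoped Classical
open Function Field NumberField IsDedekindDomain WeierstrassCurve
open Literature.NumberTheory.EllipticCurves Literature.NumberTheory.GaloisRepresentations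
open Literature.NumberTheory
open Summit.BirchSwinnertonDyer.Rank1Residual.JET.GlobalDuality (galoisRep_toLocal_apply_eq_self)
open Summit.BirchSwinnertonDyer.BirchSwinnertonDyer.Theorems.GenusExact

namespace Summit.BirchSwinnertonDyer.BirchSwinnertonDyer.Theorems.GenusExact.PlusDescent

variable (W : WeierstrassCurve ℚ) [W.IsElliptic] [W.IsGloballyMinimal] [NeZero (W.conductorNorm ℤ)]
variable (K : Type) [Field K] [NumberField K]

/-! ## §1 Level `2^L`: the full-order signed pair at a transposition-deep Kolyvagin prime beyond a bound -/

/-- **The full-order signed pair at a TRANSPOSITION-deep Kolyvagin prime beyond every bound, level `2^L` (`L ≥ 1`), any sign of `Δ`.**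
`E/ℚ` globally minimal with `ρ_{E,2^n}` onto (`n ≥ 1`), `K` imaginary quadratic with odd `d_K` Heegner for `N_E`, `c ≠ 1` in `Gal(K/ℚ)`; two
`c`-eigenclasses `x, y ∈ H¹(K, E[2^L])` of orders `2^m, 2^κ` (`m, κ ≥ 1`, any signs) with the separation hypothesis on `⟨x, y⟩`; then beyond
`b` there is a Zhang–Kolyvagin prime `ℓ` at `2` of index `≥ L`, some arithmetic Frobenius above which moves a point of `E[2]`, at whose place
`2^j·x ∈ torsionLocalKer ⟺ m ≤ j` and `2^j·y ∈ torsionLocalKer ⟺ κ ≤ j`.  (gk2-p4 g23 Part C read through gk2-p5 g31's adapters, bound kept.)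
[cite: McCallumLMS1991, §3 Cor. 3.2, §5 Prop. 5.2 (proof, (11)–(13))] [cite: GrossLMS1991, §3 (3.1)–(3.3), §9 Prop. 9.3] -/
theorem exists_transposition_kolyvaginPrime_fullOrder_pair_gt (hK : IsImaginaryQuadratic K) (hodd : Odd (NumberField.discr K))
    (hH : SatisfiesHeegnerHypothesis (W.conductorNorm ℤ) K) (hρ : ∀ n : ℕ, W.HasSurjectiveModNGaloisRep (2 ^ n : ℕ))
    {c : K ≃ₐ[ℚ] K} (hc : c ≠ 1) {L : ℕ} (hL : 1 ≤ L)
    (x y : galH1Torsion (W.baseChange K) ((2 ^ L : ℕ) : ℤ))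
    {m κ : ℕ} (hm : 1 ≤ m) (hκ : 1 ≤ κ) (hx : addOrderOf x = 2 ^ m) (hy : addOrderOf y = 2 ^ κ)
    {sx sy : ℤ} (hsx : sx = 1 ∨ sx = -1) (hsy : sy = 1 ∨ sy = -1)
    (hτx : conjAct W c ((2 ^ L : ℕ) : ℤ) x = sx • x) (hτy : conjAct W c ((2 ^ L : ℕ) : ℤ) y = sy • y)
    (hres : ∀ a b : ℤ, (∀ ρ ∈ torsionFixing (W.baseChange K) ((2 ^ L : ℕ) : ℤ),
      h1Eval (W.baseChange K) ((2 ^ L : ℕ) : ℤ) (a • x + b • y) ρ = 0) → a • x + b • y = 0)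
    (b : ℕ) :
    ∃ ℓ : ℕ, b < ℓ ∧ Zhang2014.IsKolyvaginPrime (W.conductorNorm ℤ) W K 2 ℓ ∧ L ≤ Zhang2014.kolyvaginIndex W 2 ℓ ∧
      (∃ (v : HeightOneSpectrum (𝓞 ℚ)) (𝔓 : Ideal (absIntegers (𝓞 ℚ) ℚ)) (h : absoluteGaloisGroup ℚ),
        (ℓ : 𝓞 ℚ) ∈ v.asIdeal ∧ 𝔓 ∈ v.primesAbove ∧ IsArithFrobAt (𝓞 ℚ) h 𝔓 ∧ ∃ u : geomTorsion W 2, h • u ≠ u) ∧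
      ∀ w : HeightOneSpectrum (𝓞 K), (ℓ : 𝓞 K) ∈ w.asIdeal →
        (∀ j : ℕ, ((2 ^ j : ℕ) : ℤ) • x ∈ (W.baseChange K).torsionLocalKer (w.adicCompletion K) ((2 ^ L : ℕ) : ℤ) ↔ m ≤ j) ∧
        (∀ j : ℕ, ((2 ^ j : ℕ) : ℤ) • y ∈ (W.baseChange K).torsionLocalKer (w.adicCompletion K) ((2 ^ L : ℕ) : ℤ) ↔ κ ≤ j) := by
  haveI : Fact (Nat.Prime 2) := ⟨Nat.prime_two⟩
  obtain ⟨n, rfl⟩ : ∃ n, L = n + 1 := ⟨L - 1, by omega⟩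
  obtain ⟨c₀, hc₀⟩ := exists_isComplexConjugation (Rat.castHom ℝ)
  have hρ2 : W.HasSurjectiveModNGaloisRep 2 := by simpa using hρ 1
  have hsurj : W.HasSurjectiveModNGaloisRep ((2 ^ (n + 1) : ℕ) : ℤ) := by exact_mod_cast hρ (n + 1)
  obtain ⟨ρ, hsq, -, ⟨P, hPplus, -⟩, ℓ, hbℓ, hℓp, hℓN, hℓdK, hℓ2, hℓprime, ⟨v, 𝔓, h, hℓv, h𝔓, hh, hE, -⟩, hdvd1, hdvda, hloc⟩ :=
    RegularSigned.exists_regular_kolyvaginPrime_fullOrder_signedPair_of_heegner (W := W) (N := W.conductorNorm ℤ)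
      Literature.NumberTheory.Automorphic.chebotarev_artinRep_of_galoisSide hK hodd hH n hρ2 hsurj hc₀ hc x y hm hκ hx hy hsx hsy hτx
      hτy hres b
  have hidx : n + 1 ≤ Zhang2014.kolyvaginIndex W 2 ℓ :=
    Zhang2014.le_kolyvaginIndex_iff.mpr ⟨hdvd1, by exact_mod_cast hdvda⟩
  obtain ⟨u, hu⟩ := exists_smul_ne_twoTorsion_of_regular_witness W hE ⟨P, hPplus⟩
  exact ⟨ℓ, hbℓ, ⟨hℓp, hℓN, hℓdK, hℓ2, hℓprime, lt_of_lt_of_le (Nat.succ_pos n) hidx⟩, hidx,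
    ⟨v, 𝔓, h, hℓv, h𝔓, hh, u, hu⟩, hloc⟩

/-! ## §2 The deep form: level-`2^M` classes, a transposition-deep prime of index `≥ M + k` outside any finite set -/

/-- **THE DEEP FULL-ORDER PAIR ČEBOTAREV AT TRANSPOSITION-DEEP PRIMES (any sign of `Δ`).**  Frame as in §1; `M ≥ 1`, any `k`; eigenclasses
`x, y ∈ H¹(K, E[2^M])` (`c_* x = ±x`, `c_* y = ±y`, any signs) of orders `2^m`, `2^κ` (`m, κ ≥ 1`), with the separation hypothesis for
`⟨x, y⟩` read at the DEEP level through `ι = H¹(E[2^M] ↪ E[2^{M+k}])` («`ι(a x + b y)` dies on `Γ_{K(E[2^{M+k}])}` ⟹ `a x + b y = 0`»).  Then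
outside any finite `X` there is a Zhang–Kolyvagin prime `ℓ` at `2` of index `≥ M + k`, some arithmetic Frobenius above which MOVES A POINT OF
`E[2]`, at whose place `x` has local order exactly `2^m` and `y` exactly `2^κ` (level-`2^M` local kernels).  SAME conclusion shape as
`infinite_kolyvaginPrime_localization_fullOrder_pair_deep` with `FrobEqFrobInfty W K (2^(M+k)) ℓ` replaced by the transposition clause and the
hypotheses `¬ CM`, `Δ < 0`, `d_K·(−|Δ|)` non-square replaced by `d_K` odd + Heegner.  (Proof adapted from `…RTDeepPairChebotarev`: §1 at level
`2^{M+k}` for `ι x, ι y`, then the `x_λ`-clauses `↔` the `(ι x)_λ`-clauses because `Γ_{K_λ}` fixes `E[2^{M+k}]`.)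
[cite: McCallumLMS1991, §3 Cor. 3.2, §4 (5) and Lemma 4.6, §5 proof of Prop. 5.2] [cite: GrossLMS1991, §3 (3.1)–(3.3), §9 Prop. 9.3] -/
theorem exists_transposition_kolyvaginPrime_localization_fullOrder_pair_deep (hK : IsImaginaryQuadratic K)
    (hodd : Odd (NumberField.discr K)) (hH : SatisfiesHeegnerHypothesis (W.conductorNorm ℤ) K)
    (hρ : ∀ n : ℕ, W.HasSurjectiveModNGaloisRep (2 ^ n : ℕ)) (c : K ≃ₐ[ℚ] K) (hc : c ≠ 1)
    (M k : ℕ) (hM : 1 ≤ M) (x y : galH1Torsion (W.baseChange K) ((2 ^ M : ℕ) : ℤ))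
    {m κ : ℕ} (hm : 1 ≤ m) (hκ : 1 ≤ κ) (hx : addOrderOf x = 2 ^ m) (hy : addOrderOf y = 2 ^ κ)
    {sx sy : ℤ} (hsx : sx = 1 ∨ sx = -1) (hsy : sy = 1 ∨ sy = -1)
    (hτx : conjAct W c ((2 ^ M : ℕ) : ℤ) x = sx • x) (hτy : conjAct W c ((2 ^ M : ℕ) : ℤ) y = sy • y)
    (hres : ∀ a b : ℤ, (∀ ρ ∈ torsionFixing (W.baseChange K) ((2 ^ (M + k) : ℕ) : ℤ),
      h1Eval (W.baseChange K) ((2 ^ (M + k) : ℕ) : ℤ)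
        (torsionH1OfDvd (W.baseChange K) (natCast_pow_dvd_natCast_pow_add 2 M k) (a • x + b • y)) ρ = 0) →
      a • x + b • y = 0)
    (X : Finset ℕ) :
    ∃ ℓ : ℕ, ℓ ∉ X ∧ Zhang2014.IsKolyvaginPrime (W.conductorNorm ℤ) W K 2 ℓ ∧ M + k ≤ Zhang2014.kolyvaginIndex W 2 ℓ ∧
      (∃ (v : HeightOneSpectrum (𝓞 ℚ)) (𝔓 : Ideal (absIntegers (𝓞 ℚ) ℚ)) (h : absoluteGaloisGroup ℚ),
        (ℓ : 𝓞 ℚ) ∈ v.asIdeal ∧ 𝔓 ∈ v.primesAbove ∧ IsArithFrobAt (𝓞 ℚ) h 𝔓 ∧ ∃ u : geomTorsion W 2, h • u ≠ u) ∧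
      ∀ v : HeightOneSpectrum (𝓞 K), (ℓ : 𝓞 K) ∈ v.asIdeal →
        (∀ j : ℕ, ((2 ^ j : ℕ) : ℤ) • x ∈ (W.baseChange K).torsionLocalKer (v.adicCompletion K) ((2 ^ M : ℕ) : ℤ) ↔ m ≤ j) ∧
        ∀ j : ℕ, ((2 ^ j : ℕ) : ℤ) • y ∈ (W.baseChange K).torsionLocalKer (v.adicCompletion K) ((2 ^ M : ℕ) : ℤ) ↔ κ ≤ j := by
  -- (adapted from `…RTDeepPairChebotarev.infinite_kolyvaginPrime_localization_fullOrder_pair_deep`, gk2-p1 LEAD lineage)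
  haveI : Fact (Nat.Prime 2) := ⟨Nat.prime_two⟩
  haveI : (W.baseChange K).IsElliptic := inferInstanceAs (W.map (algebraMap ℚ K)).IsElliptic
  have hdvd := natCast_pow_dvd_natCast_pow_add 2 M k
  set ι := torsionH1OfDvd (W.baseChange K) hdvd with hιdef
  have hρ2 : W.HasSurjectiveModNGaloisRep 2 := by simpa using hρ 1
  have hιinj : Function.Injective ι := torsionH1OfDvd_two_pow_injective W K hK hρ2 M k
  -- ### the shifted classes
  set x' : galH1Torsion (W.baseChange K) ((2 ^ (M + k) : ℕ) : ℤ) := ι x with hx'def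
  set y' : galH1Torsion (W.baseChange K) ((2 ^ (M + k) : ℕ) : ℤ) := ι y with hy'def
  have hx' : addOrderOf x' = 2 ^ m := by rw [hx'def, addOrderOf_injective ι hιinj, hx]
  have hy' : addOrderOf y' = 2 ^ κ := by rw [hy'def, addOrderOf_injective ι hιinj, hy]
  have hτx' : conjAct W c ((2 ^ (M + k) : ℕ) : ℤ) x' = sx • x' := by
    rw [hx'def, hιdef, conjAct_torsionH1OfDvd, hτx, map_zsmul]
  have hτy' : conjAct W c ((2 ^ (M + k) : ℕ) : ℤ) y' = sy • y' := by
    rw [hy'def, hιdef, conjAct_torsionH1OfDvd, hτy, map_zsmul]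
  have hres' : ∀ a b : ℤ, (∀ ρ ∈ torsionFixing (W.baseChange K) ((2 ^ (M + k) : ℕ) : ℤ),
      h1Eval (W.baseChange K) ((2 ^ (M + k) : ℕ) : ℤ) (a • x' + b • y') ρ = 0) → a • x' + b • y' = 0 := by
    intro a b hab
    have heq : a • x' + b • y' = ι (a • x + b • y) := by rw [map_add, map_zsmul, map_zsmul]
    rw [heq] at hab ⊢
    rw [hres a b hab, map_zero]
  have hMk : 1 ≤ M + k := le_trans hM (Nat.le_add_right M k)
  obtain ⟨ℓ, hbℓ, hKol, hidx, hR, hloc⟩ := exists_transposition_kolyvaginPrime_fullOrder_pair_gt W K hK hodd hH hρ hc hMk x' y' hm hκ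
    hx' hy' hsx hsy hτx' hτy' hres' (X.sup id)
  have hℓX : ℓ ∉ X := fun h ↦ by
    have : ℓ ≤ X.sup id := Finset.le_sup (f := id) h
    omega
  refine ⟨ℓ, hℓX, hKol, hidx, hR, fun v hv ↦ ?_⟩
  obtain ⟨hlx, hly⟩ := hloc v hv
  -- ### `Γ_{K_λ}` fixes `E[2^{M+k}]`: the level-`2^M` and level-`2^{M+k}` local kernels agree along `ι`
  have htriv : ∀ (g : absoluteGaloisGroup (v.adicCompletion K)) (Q : geomTorsion (W.baseChange K) ((2 ^ (M + k) : ℕ) : ℤ)),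
      resGal (K := K) (v.adicCompletion K) g • Q = Q := fun g Q ↦ by
    rw [resGal_eq_absGaloisRestrict]
    exact galoisRep_toLocal_apply_eq_self W K hK hKol hidx v hv g Q
  have hpd : 2 ^ M ∣ 2 ^ (M + k) := pow_dvd_pow 2 (Nat.le_add_right M k)
  have e : ∀ z : galH1Torsion (W.baseChange K) ((2 ^ M : ℕ) : ℤ),
      z ∈ (W.baseChange K).torsionLocalKer (v.adicCompletion K) ((2 ^ M : ℕ) : ℤ) ↔
        ι z ∈ (W.baseChange K).torsionLocalKer (v.adicCompletion K) ((2 ^ (M + k) : ℕ) : ℤ) := fun z ↦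
    mem_torsionLocalKer_iff_torsionH1OfDvd_mem (W.baseChange K) (v.adicCompletion K) hpd (pow_ne_zero M two_ne_zero)
      (pow_ne_zero _ two_ne_zero) htriv z
  refine ⟨fun j ↦ ?_, fun j ↦ ?_⟩
  · rw [e, map_zsmul]
    exact hlx j
  · rw [e, map_zsmul]
    exact hly j

end Summit.BirchSwinnertonDyer.BirchSwinnertonDyer.Theorems.GenusExact.PlusDescent

end
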